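import Literature.AlgebraicGeometry.Frobenioids.TwoLevelFrobenioidMorphisms
import Literature.AlgebraicGeometry.Frobenioids.IrreducibleMorphismsCounterexample
import Literature.AlgebraicGeometry.Frobenioids.PreFrobenioidPullbacks
import HarnessLib

/-!
# The two-level Frobenioid over `B(ℤ/2)`: Definition 1.3, clauses (i)–(iii)

Mochizuki, *The geometry of Frobenioids I: the general theory*, Kyushu J. Math. **62** (2008)
293–400, §1, Definition 1.3 pp. 24–25 [cite: MochizukiFrdI2008, Def. 1.3 p.24] — verified, clause
by clause, for OUR two-object test category `C → F_Φ` of `TwoLevelFrobenioid.lean` (finding F-t8g2-1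
of the abc-iut cell; not a construction of the paper). This file: the pre-Frobenioid conditions and
clauses (i)(a)(b)(c), (ii), (iii)(a)–(d). Clauses (iv)–(vii) and the assembled `IsFrobenioid` are in
`TwoLevelFrobenioidIsFrobenioid.lean`.  Nothing here bears on [IUTchIII].
-/

namespace Literature.AlgebraicGeometry.Frobenioids

open CategoryTheory Opposite

namespace TwoLevel

open PreFrobenioid

/-! ### Small constructors (as existence statements) -/

/-- Every parity is the parity of a base automorphism. [cite: MochizukiFrdI2008, Prop. 1.6 p.28] -/
theorem exists_base_of_par (z : M) : ∃ g : X, eps g = par z := ⟨Multiplicative.ofAdd (par z), rfl⟩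

/-- Every base automorphism has a divisor of its parity. [cite: MochizukiFrdI2008, Prop. 1.6 p.28] -/
theorem exists_div_of_eps (g : X) : ∃ z : M, par z = eps g :=
  ⟨Multiplicative.ofAdd (eps g).val, by rw [par_ofAdd, ZMod.natCast_zmod_val]⟩

/-- The parity rule for a linear endomorphism of `A`, conditionally on `A = low`.
[cite: MochizukiFrdI2008, Prop. 1.6 p.28] -/
theorem par_of_eq_low {A : Obj} (f : A ⟶ A) (hA : A = Obj.low) : par (dv f.1) = eps (bs f.1) := by
  subst hA; exact par_low f

/-- The linear endomorphism `(g, z, 1)` of an object exists (for `low` under the parity rule) and is a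
co-angular pre-step. [cite: MochizukiFrdI2008, Prop. 1.6 p.28] -/
theorem exists_endOf (A : Obj) (g : X) (z : M) (h : A = Obj.low → par z = eps g) :
    ∃ f : A ⟶ A, f.1 = tr g z 1 ∧ IsCoAngularPreStep toElem f := by
  cases A
  · exact ⟨lowEnd g z (h rfl), rfl, isCoAngularPreStep_low _⟩
  · exact ⟨toTop Obj.top g z 1, rfl, isCoAngularPreStep_top rfl⟩

/-! ### Epimorphisms -/

/-- Every arrow of `C` is an epimorphism (componentwise cancellation). [cite: MochizukiFrdI2008, §0 p.15] -/
theorem epi {A B : Obj} (f : A ⟶ B) : Epi f := by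
  refine ⟨fun g h e => hom_ext (E_ext ?_ ?_ ?_)⟩
  all_goals have e' := congrArg Subtype.val e; simp only [comp_val] at e'
  · have := congrArg bs e'; rw [bs_comp, bs_comp] at this; exact mul_right_cancel this
  · have hd := congrArg dg e'; rw [dg_comp, dg_comp] at hd
    have hd' : dg g.1 = dg h.1 := mul_left_cancel hd
    have := congrArg dv e'; rw [dv_comp, dv_comp, hd'] at this; exact mul_right_cancel this
  · have := congrArg dg e'; rw [dg_comp, dg_comp] at this; exact mul_left_cancel this

/-- Pre-steps of `C` are monomorphisms. [cite: MochizukiFrdI2008, Def. 1.3(v) p.25] -/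
theorem mono_of_linear {A B : Obj} (f : A ⟶ B) (hf : dg f.1 = 1) : Mono f := by
  refine ⟨fun g h e => hom_ext (E_ext ?_ ?_ ?_)⟩
  all_goals have e' := congrArg Subtype.val e; simp only [comp_val] at e'
  · have := congrArg bs e'; rw [bs_comp, bs_comp] at this; exact mul_left_cancel this
  · have := congrArg dv e'; rw [dv_comp, dv_comp, hf, PNat.one_coe, pow_one, pow_one] at this
    exact mul_left_cancel this
  · have := congrArg dg e'; rw [dg_comp, dg_comp] at this; exact mul_right_cancel this

/-! ### Pre-Frobenioid conditions -/

/-- `Φ ≡ ℤ_{≥0}` is a monoid on `B(ℤ/2)` (identity pull-backs). [cite: MochizukiFrdI2008, Def. 1.1(ii) p.19] -/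
theorem isMonoidOn_Φ : IsMonoidOn Φ where
  isCharInjective f := by
    refine ⟨fun x y h => h, fun x y hxy => ?_⟩
    obtain ⟨a, rfl⟩ := Associates.mk_surjective x
    obtain ⟨b, rfl⟩ := Associates.mk_surjective y
    rw [associatesMap_mk, associatesMap_mk] at hxy
    exact hxy
  bijective_of_isFSM f _ := ⟨fun x y h => h, fun y => ⟨y, rfl⟩⟩

/-- `Φ` is objectwise divisorial (`ℤ_{≥0}` is pre-divisorial and sharp). [cite: MochizukiFrdI2008, Def. 1.1(i) p.19] -/
theorem isDivisorial_Φ : Objectwise (fun N _ => IsDivisorial N) Φ := fun _ =>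
  { isPreDivisorial := StandardFrobenioidExample.isPreDivisorial_M
    isSharp := StandardFrobenioidExample.isSharp_M }

/-- `B(ℤ/2)` is connected. [cite: MochizukiFrdI2008, §0 p.16] -/
theorem isGraphConnected_D : IsGraphConnected D :=
  ⟨⟨SingleObj.star X⟩, fun _ _ => Zigzag.refl _⟩

/-- `B(ℤ/2)` is totally epimorphic (a groupoid). [cite: MochizukiFrdI2008, §0 p.15] -/
theorem isTotallyEpimorphic_D : IsTotallyEpimorphic D :=
  ⟨fun f => by haveI := isIso_base f; infer_instance⟩

/-- `C` is connected (`low → top` exists). [cite: MochizukiFrdI2008, §0 p.16] -/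
theorem isGraphConnected_C : IsGraphConnected Obj := by
  refine ⟨⟨Obj.low⟩, fun A B => ?_⟩
  have hlt : Zigzag Obj.low Obj.top := Zigzag.of_hom (hHom 1)
  cases A <;> cases B
  · exact Zigzag.refl _
  · exact hlt
  · exact hlt.symm
  · exact Zigzag.refl _

/-- `C` is totally epimorphic. [cite: MochizukiFrdI2008, §0 p.15] -/
theorem isTotallyEpimorphic_C : IsTotallyEpimorphic Obj := ⟨fun f => epi f⟩

/-- `C → F_Φ` is a pre-Frobenioid. [cite: MochizukiFrdI2008, Def. 1.1(iv) p.20] -/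
theorem isPreFrobenioid : IsPreFrobenioid Φ toElem where
  isMonoidOn := isMonoidOn_Φ
  isDivisorial := isDivisorial_Φ
  isGraphConnected_base := isGraphConnected_D
  isTotallyEpimorphic_base := isTotallyEpimorphic_D
  isGraphConnected := isGraphConnected_C
  isTotallyEpimorphic := isTotallyEpimorphic_C

/-! ### Definition 1.3 (i) -/

/-- (i)(a): `top` is a Frobenius-trivial object over the unique object of `D`. [cite: MochizukiFrdI2008, Def. 1.3(i) p.24] -/
theorem i_a (A₀ : D) : ∃ A : Obj, IsFrobeniusTrivial toElem A ∧ Nonempty (baseObj toElem A ≅ A₀) :=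
  ⟨Obj.top, isFrobeniusTrivial_top, ⟨Iso.refl _⟩⟩

/-- (i)(b): base automorphisms are ratios of bases of pre-steps out of `low` (resp. `top`).
[cite: MochizukiFrdI2008, Def. 1.3(i) p.24] -/
theorem i_b (A B : Obj) (α : baseObj toElem A ≅ baseObj toElem B) :
    ∃ (Y : Obj) (φ : Y ⟶ A) (ψ : Y ⟶ B), IsPreStep toElem φ ∧ IsPreStep toElem ψ ∧
      Base toElem φ ≫ α.hom = Base toElem ψ := by
  let a : X := α.hom
  obtain ⟨za, hza⟩ := exists_div_of_eps a
  cases A <;> cases B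
  · refine ⟨Obj.low, 𝟙 _, lowEnd a za hza, isPreStep_low _, isPreStep_low _, ?_⟩
    rw [PreFrobenioid.base_id, Category.id_comp]; rfl
  · refine ⟨Obj.low, 𝟙 _, toTop Obj.low a 1 1, isPreStep_low _, (isPreStep_iff _).mpr rfl, ?_⟩
    rw [PreFrobenioid.base_id, Category.id_comp]; rfl
  · refine ⟨Obj.low, hHom 1, lowEnd a za hza, (isPreStep_iff _).mpr rfl, isPreStep_low _, ?_⟩
    show a * (1 : X) = a
    exact mul_one a
  · refine ⟨Obj.top, 𝟙 _, toTop Obj.top a 1 1, (isPreStep_iff _).mpr rfl, (isPreStep_iff _).mpr rfl, ?_⟩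
    rw [PreFrobenioid.base_id, Category.id_comp]; rfl

/-- (i)(c): `C^pl-bk_A → D_{A_D}` is an equivalence (pull-backs are the isomorphisms; the base is a
groupoid, so the identity pull-back reaches every object of the slice). [cite: MochizukiFrdI2008, Def. 1.3(i) p.24] -/
theorem i_c (A : Obj) : (pullbackSliceToBase toElem A).IsEquivalence := by
  haveI := pullbackSliceToBase_faithful toElem A
  haveI := pullbackSliceToBase_full toElem A
  haveI : (pullbackSliceToBase toElem A).EssSurj := by
    refine ⟨fun Y => ?_⟩
    let y : X := Y.hom
    let e : (wideSubcategoryInclusion (pullbackMorphisms toElem) ⋙ baseFunctor toElem).obj ⟨A⟩ ≅ Y.left :=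
      ⟨(y⁻¹ : X), (y : X), show y * y⁻¹ = (1 : X) from mul_inv_cancel y,
        show y⁻¹ * y = (1 : X) from inv_mul_cancel y⟩
    refine ⟨Over.mk (𝟙 (⟨A⟩ : PullbackCat toElem)), ⟨Over.isoMk e ?_⟩⟩
    show y * y⁻¹ = bs (𝟙 E)
    rw [mul_inv_cancel, bs_id]
  exact {}

/-! ### Definition 1.3 (ii) -/

/-- (ii), existence: Frobenius-type arrows of every degree out of every object. [cite: MochizukiFrdI2008, Def. 1.3(ii) p.24] -/
theorem ii_exists (A : Obj) (n : ℕ+) :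
    ∃ (B : Obj) (φ : A ⟶ B), IsFrobeniusType toElem φ ∧ degFr toElem φ = n := by
  by_cases hn : n = 1
  · subst hn
    refine ⟨A, 𝟙 A, (isFrobeniusType_iff _).mpr ⟨rfl, ?_⟩, rfl⟩
    rintro ⟨h1, h2, -⟩; exact Obj.noConfusion (h1.symm.trans h2)
  · exact ⟨Obj.top, toTop A 1 1 n, isFrobeniusType_toTop 1 n (Or.inr hn), rfl⟩

/-- (ii), essential uniqueness of Frobenius-type arrows of a given degree. [cite: MochizukiFrdI2008, Def. 1.3(ii) p.24] -/
theorem ii_unique {A B B' : Obj} (φ : A ⟶ B) (ψ : A ⟶ B') (hφ : IsFrobeniusType toElem φ)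
    (hψ : IsFrobeniusType toElem ψ) (hn : degFr toElem φ = degFr toElem ψ) :
    ∃ β : B ≅ B', φ ≫ β.hom = ψ := by
  rw [isFrobeniusType_iff] at hφ hψ
  have hn' : dg φ.1 = dg ψ.1 := hn
  cases B <;> cases B'
  · -- both land in `low`: then `A = low` and both are the identity
    cases A
    · haveI : IsIso φ := (isIso_iff φ).mpr ⟨rfl, dg_low φ, hφ.1⟩
      haveI : IsIso ψ := (isIso_iff ψ).mpr ⟨rfl, dg_low ψ, hψ.1⟩
      refine ⟨Iso.refl _, ?_⟩
      rw [Iso.refl_hom, Category.comp_id, eq_id_of_isIso_low φ, eq_id_of_isIso_low ψ]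
    · exact (no_top_low φ).elim
  · cases A
    · exact (hψ.2 ⟨rfl, rfl, hn' ▸ dg_low φ⟩).elim
    · exact (no_top_low φ).elim
  · cases A
    · exact (hφ.2 ⟨rfl, rfl, hn'.symm ▸ dg_low ψ⟩).elim
    · exact (no_top_low ψ).elim
  · refine ⟨topAut ((bs φ.1)⁻¹ * bs ψ.1), hom_ext (E_ext ?_ ?_ ?_)⟩
    · simp [mul_comm]
    · simp [hφ.1, hψ.1]
    · simp [hn']

/-! ### Definition 1.3 (iii) -/

/-- (iii)(a): co-angular arrows compose (degree count). [cite: MochizukiFrdI2008, Def. 1.3(iii) p.24] -/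
theorem iii_a {A B B' : Obj} (f : A ⟶ B) (g : B ⟶ B') (hf : IsCoAngular toElem f)
    (hg : IsCoAngular toElem g) : IsCoAngular toElem (f ≫ g) := by
  rw [isCoAngular_iff] at hf hg ⊢
  rintro ⟨rfl, rfl, h⟩
  rw [comp_val, dg_comp] at h
  have h1 : dg f.1 = 1 := pnat_eq_one_of_mul_eq_one h
  have h2 : dg g.1 = 1 := by rw [h1, one_mul] at h; exact h
  cases B
  · exact hg ⟨rfl, rfl, h2⟩
  · exact hf ⟨rfl, rfl, h1⟩

/-- (iii)(b): if some `A' → A` is a co-angular pre-step (so `A' = A`), every `A' → A` is co-angular.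
[cite: MochizukiFrdI2008, Def. 1.3(iii) p.24] -/
theorem iii_b {A' A : Obj} (φ : A' ⟶ A) (hφ : IsCoAngularPreStep toElem φ) (ψ : A' ⟶ A) :
    IsCoAngular toElem ψ := by
  obtain ⟨rfl, -⟩ := (isCoAngularPreStep_iff φ).mp hφ
  rw [isCoAngular_iff]
  rintro ⟨h1, h2, -⟩; exact Obj.noConfusion (h1.symm.trans h2)

/-- (iii)(c): along a co-angular pre-step (a linear endomorphism) the identity `O^▷(A) ≃ O^▷(A)`
intertwines (everything commutes componentwise). [cite: MochizukiFrdI2008, Def. 1.3(iii) p.24] -/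
theorem iii_c {A B : Obj} (φ : A ⟶ B) (hφ : IsCoAngularPreStep toElem φ) :
    ∃ e : endSubmonoid toElem A ≃* endSubmonoid toElem B,
      ∀ α : endSubmonoid toElem A, φ ≫ (show B ⟶ B from (e α).1) = (show A ⟶ A from α.1) ≫ φ := by
  obtain ⟨rfl, hφ1⟩ := (isCoAngularPreStep_iff φ).mp hφ
  refine ⟨MulEquiv.refl _, fun α => hom_ext (E_ext ?_ ?_ ?_)⟩
  · show bs (φ.1 ≫ (show A ⟶ A from α.1).1) = bs ((show A ⟶ A from α.1).1 ≫ φ.1)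
    rw [bs_comp, bs_comp, mul_comm]
  · have hα1 : dg (show A ⟶ A from α.1).1 = 1 := α.2.2
    show dv (φ.1 ≫ (show A ⟶ A from α.1).1) = dv ((show A ⟶ A from α.1).1 ≫ φ.1)
    rw [dv_comp, dv_comp, hα1, hφ1, PNat.one_coe, pow_one, pow_one, mul_comm]
  · show dg (φ.1 ≫ (show A ⟶ A from α.1).1) = dg ((show A ⟶ A from α.1).1 ≫ φ.1)
    rw [dg_comp, dg_comp, mul_comm]

/-- (iii)(c), dependence on `Base(φ)` only: the intertwined element is determined (cancellation).
[cite: MochizukiFrdI2008, Def. 1.3(iii) p.24] -/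
theorem iii_c_base {A B : Obj} (φ φ' : A ⟶ B) (hφ : IsCoAngularPreStep toElem φ)
    (hφ' : IsCoAngularPreStep toElem φ') (_hb : Base toElem φ = Base toElem φ')
    (α : endSubmonoid toElem A) (β β' : endSubmonoid toElem B)
    (h : φ ≫ (show B ⟶ B from β.1) = (show A ⟶ A from α.1) ≫ φ)
    (h' : φ' ≫ (show B ⟶ B from β'.1) = (show A ⟶ A from α.1) ≫ φ') : β = β' := by
  obtain ⟨rfl, hφ1⟩ := (isCoAngularPreStep_iff φ).mp hφ
  have hφ1' : dg φ'.1 = 1 := ((isCoAngularPreStep_iff φ').mp hφ').2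
  have hβ1 : dg β.1.1 = 1 := β.2.2
  have hβ1' : dg β'.1.1 = 1 := β'.2.2
  have hβb : bs β.1.1 = 1 := β.2.1
  have hβb' : bs β'.1.1 = 1 := β'.2.1
  have hd : dv β.1.1 = dv α.1.1 := by
    have e := congrArg (fun f : A ⟶ A => dv f.1) h
    simp only [comp_val, dv_comp, hβ1, hφ1, PNat.one_coe, pow_one] at e
    rw [mul_comm (dv φ.1)] at e
    exact mul_right_cancel e
  have hd' : dv β'.1.1 = dv α.1.1 := by
    have e := congrArg (fun f : A ⟶ A => dv f.1) h'
    simp only [comp_val, dv_comp, hβ1', hφ1', PNat.one_coe, pow_one] at e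
    rw [mul_comm (dv φ'.1)] at e
    exact mul_right_cancel e
  exact Subtype.ext (hom_ext (E_ext (hβb.trans hβb'.symm) (hd.trans hd'.symm) (hβ1.trans hβ1'.symm)))

/-- (iii)(d), coslice, fullness: `Div φ ∣ Div φ'` lifts to a co-angular pre-step under `A` (the
parity of the quotient is the difference of the parities). [cite: MochizukiFrdI2008, Def. 1.3(iii) p.24] -/
theorem iii_d_under_full {A B B' : Obj} (φ : A ⟶ B) (φ' : A ⟶ B') (hφ : IsCoAngularPreStep toElem φ)
    (hφ' : IsCoAngularPreStep toElem φ') (hdiv : Div toElem φ ∣ Div toElem φ') :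
    ∃ f : B ⟶ B', IsCoAngularPreStep toElem f ∧ φ ≫ f = φ' := by
  obtain ⟨rfl, hφ1⟩ := (isCoAngularPreStep_iff φ).mp hφ
  obtain ⟨rfl, hφ1'⟩ := (isCoAngularPreStep_iff φ').mp hφ'
  obtain ⟨c', hc⟩ := hdiv
  let c : M := c'
  have hc' : dv φ'.1 = dv φ.1 * c := hc
  have hpar : A = Obj.low → par c = eps ((bs φ.1)⁻¹ * bs φ'.1) := by
    intro hA
    have h1 := par_of_eq_low φ hA; have h2 := par_of_eq_low φ' hA
    rw [hc', par_mul, h1] at h2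
    rw [eps_mul, eps_inv, ← h2, ← add_assoc, CharTwo.add_self_eq_zero, zero_add]
  obtain ⟨f, hf, hfc⟩ := exists_endOf A ((bs φ.1)⁻¹ * bs φ'.1) c hpar
  refine ⟨f, hfc, hom_ext (E_ext ?_ ?_ ?_)⟩
  · rw [comp_val, bs_comp, hf, bs_tr, mul_comm, ← mul_assoc, mul_inv_cancel, one_mul]
  · rw [comp_val, dv_comp, hf, dv_tr, dg_tr, PNat.one_coe, pow_one, hc', mul_comm]
  · rw [comp_val, dg_comp, hf, dg_tr, hφ1, hφ1', mul_one]

/-- (iii)(d), coslice, essential surjectivity: every divisor is the divisor of a linear endomorphism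
(for `low`, with base of the matching parity). [cite: MochizukiFrdI2008, Def. 1.3(iii) p.24] -/
theorem iii_d_under_surj (A : Obj) (x : Φ.obj (op (baseObj toElem A))) :
    ∃ (B : Obj) (φ : A ⟶ B), IsCoAngularPreStep toElem φ ∧ Div toElem φ = x := by
  let z : M := x
  obtain ⟨g, hg⟩ := exists_base_of_par z
  obtain ⟨f, hf, hfc⟩ := exists_endOf A g z (fun _ => hg.symm)
  exact ⟨A, f, hfc, show dv f.1 = z by rw [hf, dv_tr]⟩

/-- `invDiv` is `Div` (the action of `B(ℤ/2)` on `ℤ_{≥0}` is trivial). [cite: MochizukiFrdI2008, Def. 1.3(iii) p.24] -/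
theorem invDiv_eq {A B : Obj} (ψ : B ⟶ A) (h : IsBaseIso toElem ψ) : invDiv toElem ψ h = dv ψ.1 := rfl

/-- (iii)(d), slice, fullness: `invDiv ψ' ∣ invDiv ψ` lifts to a co-angular pre-step over `A`.
[cite: MochizukiFrdI2008, Def. 1.3(iii) p.24] -/
theorem iii_d_over_full {A B B' : Obj} (ψ : B ⟶ A) (ψ' : B' ⟶ A) (h : IsCoAngularPreStep toElem ψ)
    (h' : IsCoAngularPreStep toElem ψ') (hdiv : invDiv toElem ψ' h'.2.2 ∣ invDiv toElem ψ h.2.2) :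
    ∃ g : B ⟶ B', IsCoAngularPreStep toElem g ∧ g ≫ ψ' = ψ := by
  obtain ⟨rfl, hψ1⟩ := (isCoAngularPreStep_iff ψ).mp h
  obtain ⟨rfl, hψ1'⟩ := (isCoAngularPreStep_iff ψ').mp h'
  rw [invDiv_eq, invDiv_eq] at hdiv
  obtain ⟨c', hc⟩ := hdiv
  let c : M := c'
  have hc' : dv ψ.1 = dv ψ'.1 * c := hc
  have hpar : B' = Obj.low → par c = eps (bs ψ.1 * (bs ψ'.1)⁻¹) := by
    intro hB
    have h1 := par_of_eq_low ψ hB; have h2 := par_of_eq_low ψ' hB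
    rw [hc', par_mul, h2] at h1
    rw [eps_mul, eps_inv, ← h1, add_comm (eps (bs ψ'.1)), add_assoc, CharTwo.add_self_eq_zero, add_zero]
  obtain ⟨f, hf, hfc⟩ := exists_endOf B' (bs ψ.1 * (bs ψ'.1)⁻¹) c hpar
  refine ⟨f, hfc, hom_ext (E_ext ?_ ?_ ?_)⟩
  · rw [comp_val, bs_comp, hf, bs_tr, ← mul_assoc, mul_comm (bs ψ'.1), mul_assoc, mul_inv_cancel,
      mul_one]
  · rw [comp_val, dv_comp, hf, dv_tr, hψ1', PNat.one_coe, pow_one, hc']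
  · rw [comp_val, dg_comp, hf, dg_tr, hψ1, hψ1', mul_one]

/-- (iii)(d), slice, essential surjectivity. [cite: MochizukiFrdI2008, Def. 1.3(iii) p.24] -/
theorem iii_d_over_surj (A : Obj) (x : Φ.obj (op (baseObj toElem A))) :
    ∃ (B : Obj) (ψ : B ⟶ A) (h : IsCoAngularPreStep toElem ψ), invDiv toElem ψ h.2.2 = x := by
  let z : M := x
  obtain ⟨g, hg⟩ := exists_base_of_par z
  obtain ⟨f, hf, hfc⟩ := exists_endOf A g z (fun _ => hg.symm)
  refine ⟨A, f, hfc, ?_⟩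
  rw [invDiv_eq, hf, dv_tr]

end TwoLevel

end Literature.AlgebraicGeometry.Frobenioids
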